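import Summits.Ventures.PercRepro.S2MidFlatsEight

/-!
# PercRepro — S2: THE MID SPANNING SETS AT CORANK `8` — AT MOST SEVEN CLOSURES (p7, gen 3; sub-claim S2)

S2MidFlatsEight shows that at corank `8` every mid closure (a `12`-point rank-`5` flat) is a `12`-subset of the
`14`-point union `W = F₁ ∪ F₂` of any two of them, giving `≤ C(14, 12) = 91` closures. Two DISTINCT mid closures
meet in a flat of rank `≤ 4`, hence in `≤ 10` points (`hflat'`), so their `2`-point complements in `W` are
DISJOINT: the closures are at most `14 / 2 = 7`. **`card_spanMid_le_seven`** — `#spanMid M 5 10 8 ≤ 7·C(12, 6)`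
(the cell `(21, 8)` of the `p = 21` row needs `≤ 42.3·C(12, 6)`; `91` does not do it, `7` does). Axioms: standard.
-/

open scoped Matroid

namespace PercRepro

namespace S2

open Set Finset

variable {α : Type} {M : Matroid α}

/-- **Two distinct `12`-point rank-`5` flats meet in at most `10` points**: their intersection is a flat of rank
`≤ 4` (rank `5` would force `F₁ = cl (F₁ ∩ F₂) = F₂`), and rank-`≤ 4` sets have `≤ 10` points. -/
theorem ncard_inter_le_ten_of_flats [M.Finite]
    (hflat' : ∀ X ⊆ M.E, M.eRk X ≤ ((5 - 1 : ℕ) : ℕ∞) → X.ncard ≤ 10)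
    {F₁ F₂ : Set α} (h₁E : F₁ ⊆ M.E) (h₁r : M.eRk F₁ = 5) (h₂r : M.eRk F₂ = 5)
    (h₁cl : M.closure F₁ = F₁) (h₂cl : M.closure F₂ = F₂) (hne : F₁ ≠ F₂) :
    (F₁ ∩ F₂).ncard ≤ 10 := by
  have h₁fin : F₁.Finite := M.ground_finite.subset h₁E
  have hIE : F₁ ∩ F₂ ⊆ M.E := Set.inter_subset_left.trans h₁E
  have hIfin : (F₁ ∩ F₂).Finite := h₁fin.subset Set.inter_subset_left
  have hIne : M.eRk (F₁ ∩ F₂) ≠ ⊤ := ((M.eRk_le_encard _).trans_lt hIfin.encard_lt_top).ne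
  obtain ⟨ri, hri⟩ := ENat.ne_top_iff_exists.1 hIne
  have hri5 : ri ≤ 5 := by
    have := M.eRk_mono (Set.inter_subset_left : F₁ ∩ F₂ ⊆ F₁)
    rw [← hri, h₁r] at this
    exact_mod_cast this
  have hri4 : ri ≤ 4 := by
    by_contra hcon
    have hri5' : ri = 5 := by omega
    have hcl₁ : M.closure (F₁ ∩ F₂) = M.closure F₁ :=
      (M.isRkFinite_of_finite hIfin).closure_eq_closure_of_subset_of_eRk_ge_eRk Set.inter_subset_left
        (by rw [h₁r, ← hri, hri5']; rfl)
    have hcl₂ : M.closure (F₁ ∩ F₂) = M.closure F₂ :=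
      (M.isRkFinite_of_finite hIfin).closure_eq_closure_of_subset_of_eRk_ge_eRk Set.inter_subset_right
        (by rw [h₂r, ← hri, hri5']; rfl)
    exact hne (by rw [← h₁cl, ← h₂cl, ← hcl₁, ← hcl₂])
  exact hflat' _ hIE (by rw [← hri]; exact_mod_cast hri4)

open scoped Classical in
/-- **The mid spanning sets at corank `8` number at most `7·C(12, 6)`**: their closures are `12`-subsets of the
`14`-point union `W` of any two of them (S2MidFlatsEight) with pairwise DISJOINT `2`-point complements in `W`. -/
theorem card_spanMid_le_seven [M.Finite]
    (hflat' : ∀ X ⊆ M.E, M.eRk X ≤ ((5 - 1 : ℕ) : ℕ∞) → X.ncard ≤ 10)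
    (hC2 : ∀ P ⊆ M.E, M.eRk P ≤ 3 → P.ncard ≤ 6) (hC0 : ∀ X ⊆ M.E, M.eRk X ≤ 1 → X.ncard ≤ 1)
    (hd : M.E.encard = M.eRank + 8) :
    (spanMid M 5 10 8).card ≤ 7 * (12).choose 6 := by
  set 𝓕 : Finset (Set α) := (spanMid M 5 10 8).image (fun S => M.closure S) with h𝓕
  -- each closure carries at most `C(12, 6)` spanning sets (as in S2MidFlatsEight)
  have hper : ∀ F ∈ 𝓕, ((spanMid M 5 10 8).filter (fun S => M.closure S = F)).card ≤ (12).choose 6 := by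
    intro F hF
    rw [h𝓕, Finset.mem_image] at hF
    obtain ⟨S₀, hS₀, rfl⟩ := hF
    obtain ⟨-, -, hc⟩ := closure_mid_eight hS₀
    have hFfin : (M.closure S₀).Finite := M.ground_finite.subset (M.closure_subset_ground _)
    have k1 : ((spanMid M 5 10 8).filter (fun S => M.closure S = M.closure S₀)).card
        ≤ (Matroid.subsF hFfin.toFinset 6).card := by
      apply Finset.card_le_card
      intro S hS
      rw [Finset.mem_filter] at hS
      obtain ⟨hSm, hScl⟩ := hS
      obtain ⟨hSa, -, -⟩ := closure_mid_eight hSm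
      obtain ⟨hSE, hSc, -⟩ := mem_spanAll.1 hSa
      apply Matroid.mem_subsF_of _ hSc
      rw [Set.Finite.coe_toFinset, ← hScl]
      exact M.subset_closure S hSE
    have k2 := Matroid.card_subsF_le hFfin.toFinset 6
    rw [← Set.ncard_eq_toFinset_card _ hFfin, hc] at k2
    exact k1.trans k2
  have hsplit : (spanMid M 5 10 8).card ≤ 𝓕.card * (12).choose 6 := by
    have h1 : spanMid M 5 10 8 =
        𝓕.biUnion (fun F => (spanMid M 5 10 8).filter (fun S => M.closure S = F)) := by
      ext S
      rw [Finset.mem_biUnion]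
      constructor
      · intro hS
        exact ⟨M.closure S, Finset.mem_image_of_mem _ hS, Finset.mem_filter.2 ⟨hS, rfl⟩⟩
      · rintro ⟨F, -, hS⟩
        exact (Finset.mem_filter.1 hS).1
    rw [h1]
    refine Finset.card_biUnion_le.trans ?_
    have h2 : ∑ F ∈ 𝓕, ((spanMid M 5 10 8).filter (fun S => M.closure S = F)).card ≤
        ∑ _F ∈ 𝓕, (12).choose 6 := Finset.sum_le_sum hper
    rw [Finset.sum_const, smul_eq_mul] at h2
    exact h2
  -- at most `7` closures
  have h𝓕card : 𝓕.card ≤ 7 := by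
    rcases Nat.lt_or_ge 𝓕.card 2 with hlt | hge
    · omega
    obtain ⟨F₁, hF₁, F₂, hF₂, hne⟩ := Finset.one_lt_card.1 hge
    have hdata : ∀ F ∈ 𝓕, F ⊆ M.E ∧ M.eRk F = 5 ∧ F.ncard = 12 ∧ M.closure F = F := by
      intro F hF
      rw [h𝓕, Finset.mem_image] at hF
      obtain ⟨S, hS, rfl⟩ := hF
      obtain ⟨-, hr, hc⟩ := closure_mid_eight hS
      exact ⟨M.closure_subset_ground _, hr, hc, M.closure_closure _⟩
    obtain ⟨h₁E, h₁r, h₁c, h₁cl⟩ := hdata F₁ hF₁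
    obtain ⟨h₂E, h₂r, h₂c, h₂cl⟩ := hdata F₂ hF₂
    obtain ⟨hWc, hWr⟩ := union_of_two_mid_flats hflat' hC2 hC0 hd h₁E h₂E h₁r h₂r h₁c h₂c h₁cl h₂cl hne
    set W := F₁ ∪ F₂ with hW
    have hWE : W ⊆ M.E := Set.union_subset h₁E h₂E
    have hWfin : W.Finite := M.ground_finite.subset hWE
    -- every closure in `𝓕` lies inside `W`
    have hsubW : ∀ F ∈ 𝓕, F ⊆ W := by
      intro F hF x hx
      obtain ⟨hFE, hFr, hFc, hFcl⟩ := hdata F hF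
      obtain ⟨C, hCF, hC, hxC⟩ := exists_isCircuit_mem_of_flat_twelve hflat' hFE hFr hFc hx
      have hCW : C ⊆ W := isCircuit_subset_of_nullity_full M hd hWE hWr (by rw [hWc]) hC
      exact hCW hxC
    -- two distinct closures cover `W`
    have hcover : ∀ F ∈ 𝓕, ∀ F' ∈ 𝓕, F ≠ F' → F ∪ F' = W := by
      intro F hF F' hF' hne'
      obtain ⟨hFE, hFr, hFc, hFcl⟩ := hdata F hF
      obtain ⟨hF'E, hF'r, hF'c, hF'cl⟩ := hdata F' hF'
      have hI := ncard_inter_le_ten_of_flats hflat' hFE hFr hF'r hFcl hF'cl hne'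
      have hFfin : F.Finite := M.ground_finite.subset hFE
      have hF'fin : F'.Finite := M.ground_finite.subset hF'E
      have hcard := Set.ncard_union_add_ncard_inter F F' hFfin hF'fin
      rw [hFc, hF'c] at hcard
      have hsub : F ∪ F' ⊆ W := Set.union_subset (hsubW F hF) (hsubW F' hF')
      exact Set.eq_of_subset_of_ncard_le hsub (by rw [hWc]; omega) hWfin
    -- the complements in `W`, as finsets
    let cF : Set α → Finset α := fun F => hWfin.toFinset.filter (fun x => x ∉ F)
    have hcF2 : ∀ F ∈ 𝓕, (cF F).card = 2 := by
      intro F hF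
      obtain ⟨hFE, -, hFc, -⟩ := hdata F hF
      have hFfin : F.Finite := M.ground_finite.subset hFE
      have hsum := Finset.card_filter_add_card_filter_not (s := hWfin.toFinset) (fun x => x ∈ F)
      have hin : hWfin.toFinset.filter (fun x => x ∈ F) = hFfin.toFinset := by
        ext x
        simp only [Finset.mem_filter, Set.Finite.mem_toFinset]
        exact ⟨fun h => h.2, fun h => ⟨hsubW F hF h, h⟩⟩
      rw [hin, ← Set.ncard_eq_toFinset_card _ hFfin, ← Set.ncard_eq_toFinset_card _ hWfin,
        hFc, hWc] at hsum
      show (hWfin.toFinset.filter (fun x => x ∉ F)).card = 2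
      omega
    have hdisj : ∀ F ∈ 𝓕, ∀ F' ∈ 𝓕, F ≠ F' → Disjoint (cF F) (cF F') := by
      intro F hF F' hF' hne'
      rw [Finset.disjoint_left]
      intro x hx hx'
      simp only [cF, Finset.mem_filter, Set.Finite.mem_toFinset] at hx hx'
      have hxW : x ∈ F ∪ F' := by rw [hcover F hF F' hF' hne']; exact hx.1
      rcases hxW with h | h
      · exact hx.2 h
      · exact hx'.2 h
    have hbi : (𝓕.biUnion cF).card = ∑ F ∈ 𝓕, (cF F).card := Finset.card_biUnion hdisj
    have hsumc : ∑ F ∈ 𝓕, (cF F).card = 𝓕.card * 2 := Finset.sum_const_nat hcF2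
    have hle : (𝓕.biUnion cF).card ≤ hWfin.toFinset.card := by
      apply Finset.card_le_card
      intro x hx
      rw [Finset.mem_biUnion] at hx
      obtain ⟨F, -, hxF⟩ := hx
      exact (Finset.mem_filter.1 hxF).1
    rw [← Set.ncard_eq_toFinset_card _ hWfin, hWc] at hle
    omega
  exact hsplit.trans (Nat.mul_le_mul_right _ h𝓕card)

end S2

end PercRepro
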